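import Literature.AlgebraicGeometry.Resolution.IdealisticExponentResolution
import Literature.AlgebraicGeometry.Resolution.RegularCentreBlowupOrder
import Literature.AlgebraicGeometry.Resolution.BlowupOffCentre
import Literature.AlgebraicGeometry.Resolution.CartierDivisorControlledTransform
import Literature.AlgebraicGeometry.Resolution.RegularSubschemeLocallyIrreducible
import Literature.AlgebraicGeometry.Resolution.BlowupDisjointCentreWeights
import Literature.AlgebraicGeometry.Resolution.MarkedIdealsArithmetic
import Literature.AlgebraicGeometry.Resolution.MonomialOrderReductionUnit
import Literature.AlgebraicGeometry.Resolution.KollarStep2Stage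
import HarnessLib

/-!
# Crux `PatchingRelPerfect` (stmt-ResolutionOfSingularities-16161), chain W5.2 — T6-E1b residual, the COMPANION CASCADE
# (res-L1-w52-idea-1's card C, Sketch v9 §1/§3): pointwise order algebra and the COMPANION marked ideal, re-homed under `Theorems`

[OURS · L1 W5.2] NOT statements of the manuscript under review (Hironaka 2017); AI-typed, weaker than expert review.
PROVENANCE: the declarations of this module are res-L1-w52-idea-1's `L/res-L1-w52-idea-1/Sketch-L1-idea-1-v9.lean`
(sha16 e94662fbcf7339d9, gen 7, farm rc 0) §1, §3, §3b VERBATIM (module 1 of 2; §4/§5 = `…DepthFlagCascadeSeq`) (docstrings included), moved from the Sketch namespace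
`…Cruxes.PatchingRelPerfect.SketchL1Idea1G7b` to `…Theorems.DepthCascade` so that D-hands can land the companion descent and the
`Cascade₂` closer against them (the ideator seat cannot propose under `Theorems`, `perm.theorems-prover-only`; filer res-D-pv-054,
as res-type-003 filed the TARGETS module p529765).  FACT-FREE: F-33 (`CossartPiltant2008_prop44`, [CoP1] Prop. 4.4 — NOT an
admissible premise of this chain) occurs only as the explicit hypothesis of `prop44From_of_prop44` / inside the parameterised
Prop `Prop44From`, and as the intended CONDITIONAL binder of `CompanionDescent`'s closer (module `…DepthFlagCascadeDescent`).

CONTENTS (idea-1's one-paragraph idea: the depth-`ℓ` E-side flag is ONE marked ideal, the BGMW sum; on a regular excellent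
THREEFOLD every «simple» step of the Encinas–Villamayor companion induction is discharged by [CoP1] Prop. 4.4 instead of a
hypersurface of maximal contact): §1 pointwise order algebra; §3 the companion `O_μ = (J, μ) + (D, N-μ)`, its support, the
cascade invariant `NoStratumAbove` (`INV(μ)`), the order bounds, transform compatibility; §4 Σ-permissible sequences, `Prop44From`,
the CHILD cascade `exists_childCascade` (PROVED for every marking `N ≥ 1` modulo `Prop44From N`); §5 stage data, the TARGET
`CompanionDescent` (one `μ`-step) and its ITERATION `companionCascade_of_descent` (PROVED).

## References
* V. Cossart, O. Piltant, J. Algebra 320 (2008), Prop. 4.2, Prop. 4.4. [CossartPiltant2008]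
* E. Bierstone, D. Grigoriev, P. Milman, J. Włodarczyk (2011), §3.1, §3.7, Lemma 3.7.1. [BierstoneGrigorievMilmanWlodarczyk2011]
* S. Encinas, O. Villamayor, *A course on constructive desingularization and equivariance* (2000) (the companion / basic objects).
  [EncinasVillamayor2000]
* J. Kollár, *Lectures on Resolution of Singularities* (2007), 3.111 Step 3. [Kollar2007]
-/

-- `Summit.<Summit>.<Sub>.Theorems` with `Sub = Summit` (single-conjunct summit, D-0017)
set_option linter.dupNamespace false

noncomputable section

open CategoryTheory CategoryTheory.Limits AlgebraicGeometry TopologicalSpace IsLocalRing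
open Literature.AlgebraicGeometry.Resolution

namespace Summit.ResolutionOfSingularities.ResolutionOfSingularities.Theorems

universe u

namespace DepthCascade

open Scheme.IdealSheafData

variable {X : Scheme.{u}}

/-! ## §1 Pointwise order algebra (folklore) -/

/-- Orders decrease as ideals increase. [folklore] -/
theorem idealOrder_anti' {I J : X.IdealSheafData} (h : I ≤ J) (x : X) :
    idealOrder J x ≤ idealOrder I x := by
  refine ENat.forall_natCast_le_iff_le.mp fun c hc => ?_
  rw [le_idealOrder_iff] at hc ⊢
  exact (stalkIdeal_mono h x).trans hc

/-- **Superadditivity `ord_x(A·B) ≥ ord_x A + ord_x B`** (every point of every scheme: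
`A_x ⊆ 𝔪^a`, `B_x ⊆ 𝔪^b ⇒ (AB)_x ⊆ 𝔪^{a+b}`; BGMW Lemma 3.7.1 (2)). [folklore] -/
theorem le_idealOrder_mul_of_le (A B : X.IdealSheafData) (x : X) {a b : ℕ}
    (ha : (a : ℕ∞) ≤ idealOrder A x) (hb : (b : ℕ∞) ≤ idealOrder B x) :
    ((a + b : ℕ) : ℕ∞) ≤ idealOrder (A * B) x := by
  rw [le_idealOrder_iff] at ha hb ⊢
  rw [stalkIdeal_mul, pow_add]
  exact Ideal.mul_mono ha hb

/-- **`ord_x(A + B) ≥ n ↔ ord_x A ≥ n ∧ ord_x B ≥ n`** (every point; BGMW §3.1). [folklore] -/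
theorem le_idealOrder_sup_iff (A B : X.IdealSheafData) (x : X) (n : ℕ) :
    (n : ℕ∞) ≤ idealOrder (A ⊔ B) x ↔ (n : ℕ∞) ≤ idealOrder A x ∧ (n : ℕ∞) ≤ idealOrder B x := by
  rw [le_idealOrder_iff, le_idealOrder_iff, le_idealOrder_iff, stalkIdeal_sup, sup_le_iff]

/-! ## §3 The companion (Encinas–Villamayor; = BGMW sum `(J, μ) + (D, N - μ)`) -/

/-- [OURS · L1 W5.2] **The companion marked ideal** of the stripped object `(D · J, N)` at the level
`μ < N`: `O_μ := (J, μ) + (D, N - μ) = (J^{N-μ} + D^{μ}, μ(N-μ))` (Encinas–Villamayor's companion of a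
basic object in the case `max w-ord < 1`; here `D` = the monomial/flag divisor, `J` = the non-divisorial
part, `B` the boundary).  NOT a statement of the manuscript. [conjecture] -/
def companion (B : List X.IdealSheafData) (D J : X.IdealSheafData) (N μ : ℕ) : MarkedIdeal X :=
  (⟨J, B, μ⟩ : MarkedIdeal X).sum ⟨D, B, N - μ⟩

/-- Unfolding: the companion ideal is `J^{N-μ} + D^{μ}`. [folklore] -/
theorem companion_ideal (B : List X.IdealSheafData) (D J : X.IdealSheafData) (N μ : ℕ) :
    (companion B D J N μ).ideal = J ^ (N - μ) ⊔ D ^ μ := rfl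

/-- Unfolding: the companion marking is `μ(N - μ)`. [folklore] -/
theorem companion_mult (B : List X.IdealSheafData) (D J : X.IdealSheafData) (N μ : ℕ) :
    (companion B D J N μ).mult = μ * (N - μ) := rfl

/-- [OURS · L1 W5.2] **Support of the companion** (regular point, `1 ≤ μ < N`):
`x ∈ Sing(O_μ) ↔ ord_x J ≥ μ ∧ ord_x D ≥ N - μ`.  PROVED (tree `mem_support_sum_iff`).
[cite: BierstoneGrigorievMilmanWlodarczyk2011, Lemma 3.7.1 (1)] -/
theorem mem_support_companion_iff (B : List X.IdealSheafData) (D J : X.IdealSheafData) {N μ : ℕ}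
    (hμ : 1 ≤ μ) (hμN : μ < N) {x : X} [IsRegularLocalRing (X.presheaf.stalk x)] :
    x ∈ (companion B D J N μ).support ↔
      (μ : ℕ∞) ≤ idealOrder J x ∧ ((N - μ : ℕ) : ℕ∞) ≤ idealOrder D x := by
  unfold companion
  rw [MarkedIdeal.mem_support_sum_iff _ _ hμ (by change 1 ≤ N - μ; omega)]
  rfl

/-- [OURS · L1 W5.2] **Companion centres are X-permissible**: `Sing(O_μ) ⊆ Sing(D · J, N)` — a regular
centre inside `Sing(O_μ)` has `ord D ≥ N - μ` and `ord J ≥ μ`, hence `ord (D·J) ≥ N`; upstairs this is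
the weight-`ℓ` permissibility `ord c_j ≥ ℓ - j ∀ j` (card §C6-2).  PROVED, every point (no regularity
needed: tree `support_inter_support_subset_support_sum/prod`).
[cite: BierstoneGrigorievMilmanWlodarczyk2011, Lemma 3.7.1 (2)] -/
theorem natCast_le_idealOrder_mul_of_mem_support_companion (B : List X.IdealSheafData)
    (D J : X.IdealSheafData) {N μ : ℕ} (hμN : μ ≤ N) {x : X} [IsRegularLocalRing (X.presheaf.stalk x)]
    (hμ : 1 ≤ μ) (hμN' : μ < N) (hx : x ∈ (companion B D J N μ).support) :
    (N : ℕ∞) ≤ idealOrder (D * J) x := by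
  obtain ⟨hJ, hD⟩ := (mem_support_companion_iff B D J hμ hμN').mp hx
  have := le_idealOrder_mul_of_le D J x hD hJ
  rwa [Nat.sub_add_cancel hμN] at this

/-- [OURS · L1 W5.2] **The cascade invariant `INV(μ)`** of the companion phases for `(D · J, N)`:
no CHILD stratum is left (`ord J < N` everywhere) and no companion stratum ABOVE `μ`
(`μ < μ' < N`, `ord_x J ≥ μ' ⇒ ord_x D < N - μ'`).  At the start of the companion phases `INV(N-1)`
holds (output of the child cascade); the END STATE is `INV(0)`.  NOT a statement of the manuscript.
[conjecture] -/
def NoStratumAbove (D J : X.IdealSheafData) (N μ : ℕ) : Prop :=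
  (∀ x, idealOrder J x < (N : ℕ∞)) ∧
    ∀ (x : X) (μ' : ℕ), μ < μ' → μ' < N → (μ' : ℕ∞) ≤ idealOrder J x →
      idealOrder D x < ((N - μ' : ℕ) : ℕ∞)

/-- `INV` is monotone: nothing above `μ` ⇒ nothing above `μ'` for `μ ≤ μ'`. [folklore] -/
theorem NoStratumAbove.mono {D J : X.IdealSheafData} {N μ μ₁ : ℕ} (h : NoStratumAbove D J N μ)
    (hle : μ ≤ μ₁) : NoStratumAbove D J N μ₁ :=
  ⟨h.1, fun x μ' h1 h2 h3 => h.2 x μ' (lt_of_le_of_lt hle h1) h2 h3⟩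

/-- [OURS · L1 W5.2] **Under `INV(μ)` the companion has order `≤ μ(N-μ)` EVERYWHERE** — the
hypothesis «`ord_x J ≤ μ` for every `x`» of [CoP1] Prop. 4.4 for `O_μ` (card §C6-3): at a point with
`ord J ≤ μ` because `ord J^{N-μ} ≤ (N-μ)μ`; at a point with `ord J = μ' > μ` because `INV` gives
`ord D ≤ N - μ' - 1`, so `ord D^μ ≤ μ(N-μ-1) < μ(N-μ)`.  PROVED (regular point).
[cite: CossartPiltant2008, Prop. 4.4 (hypotheses)] -/
theorem idealOrder_companion_le (B : List X.IdealSheafData) {D J : X.IdealSheafData} {N μ : ℕ}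
    (_hμ : 1 ≤ μ) (hμN : μ < N) (hinv : NoStratumAbove D J N μ) (x : X)
    [IsRegularLocalRing (X.presheaf.stalk x)] :
    idealOrder (companion B D J N μ).ideal x ≤ ((μ * (N - μ) : ℕ) : ℕ∞) := by
  rw [companion_ideal]
  -- the order of `J` at `x` is finite (`< N`)
  obtain ⟨a, ha⟩ := ENat.ne_top_iff_exists.mp (hinv.1 x).ne_top
  by_cases hle : a ≤ μ
  · -- `ord J^{N-μ} = (N-μ)·a ≤ (N-μ)·μ`
    calc idealOrder (J ^ (N - μ) ⊔ D ^ μ) x ≤ idealOrder (J ^ (N - μ)) x := idealOrder_anti' le_sup_left x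
      _ = (((N - μ) * a : ℕ) : ℕ∞) := idealOrder_pow_eq J ha.symm (N - μ)
      _ ≤ ((μ * (N - μ) : ℕ) : ℕ∞) := by
          exact_mod_cast (by nlinarith : (N - μ) * a ≤ μ * (N - μ))
  · -- `ord J = a > μ`: `INV` bounds `ord D`
    push Not at hle
    have haN : a < N := by
      have := hinv.1 x
      rw [← ha] at this
      exact_mod_cast this
    have hD : idealOrder D x < ((N - a : ℕ) : ℕ∞) := hinv.2 x a hle haN (by rw [ha])
    obtain ⟨b, hb⟩ := ENat.ne_top_iff_exists.mp hD.ne_top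
    have hbN : b < N - a := by rw [← hb] at hD; exact_mod_cast hD
    calc idealOrder (J ^ (N - μ) ⊔ D ^ μ) x ≤ idealOrder (D ^ μ) x := idealOrder_anti' le_sup_right x
      _ = (((μ * b : ℕ)) : ℕ∞) := idealOrder_pow_eq D hb.symm μ
      _ ≤ ((μ * (N - μ) : ℕ) : ℕ∞) := by
          exact_mod_cast Nat.mul_le_mul_left μ (by omega : b ≤ N - μ)

/-- [OURS · L1 W5.2] **The companion has maximal order exactly `μ(N-μ)` at every point of its support**
(so [CoP1] Prop. 4.4 applies to `O_μ` as soon as `Sing(O_μ) ≠ ∅`).  PROVED. [folklore] -/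
theorem idealOrder_companion_eq_of_mem_support (B : List X.IdealSheafData) {D J : X.IdealSheafData}
    {N μ : ℕ} (hμ : 1 ≤ μ) (hμN : μ < N) (hinv : NoStratumAbove D J N μ) {x : X}
    [IsRegularLocalRing (X.presheaf.stalk x)] (hx : x ∈ (companion B D J N μ).support) :
    idealOrder (companion B D J N μ).ideal x = ((μ * (N - μ) : ℕ) : ℕ∞) :=
  le_antisymm (idealOrder_companion_le B hμ hμN hinv x) hx

/-- [OURS · L1 W5.2] **On a companion centre the `J`-order is EXACTLY `μ`** (from `INV(μ)`), which is
what Giraud's non-increase (tree `IsBlowup.idealOrder_controlledTransform_le_of_mem`) needs to transport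
`INV(μ)` across the blow-up (card §C6-3).  PROVED. [folklore] -/
theorem idealOrder_eq_of_mem_support_companion (B : List X.IdealSheafData) {D J : X.IdealSheafData}
    {N μ : ℕ} (hμ : 1 ≤ μ) (hμN : μ < N) (hinv : NoStratumAbove D J N μ) {x : X}
    [IsRegularLocalRing (X.presheaf.stalk x)] (hx : x ∈ (companion B D J N μ).support) :
    idealOrder J x = μ := by
  obtain ⟨hJ, hD⟩ := (mem_support_companion_iff B D J hμ hμN).mp hx
  refine le_antisymm ?_ hJ
  by_contra hlt
  push Not at hlt
  have hμ1 : ((μ + 1 : ℕ) : ℕ∞) ≤ idealOrder J x := by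
    have := Order.add_one_le_of_lt hlt
    exact_mod_cast this
  by_cases h1N : μ + 1 < N
  · have h' : ((N - μ : ℕ) : ℕ∞) < ((N - (μ + 1) : ℕ) : ℕ∞) :=
      lt_of_le_of_lt hD (hinv.2 x (μ + 1) (Nat.lt_succ_self μ) h1N hμ1)
    have : N - μ < N - (μ + 1) := by exact_mod_cast h'
    omega
  · -- `μ + 1 = N`: the child invariant `ord J < N` is violated
    have hN : N = μ + 1 := by omega
    have := hinv.1 x
    rw [hN] at this
    exact absurd hμ1 (not_le.mpr this)

/-! ## §3b Transform compatibility (one blow-up; tree BGMW Lemma 3.7.1 «moreover») -/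

section Transform

variable {X' : Scheme.{u}} {τ : X' ⟶ X} {C : X.IdealSheafData}

/-- [OURS · L1 W5.2] **The controlled transforms commute with the companion**:
`O_μ' = (J', μ) + (D', N-μ)` with `J' = 𝓘^{-μ} J𝒪`, `D' = 𝓘^{-(N-μ)} D𝒪` — so a permissible sequence
of [CoP1] Prop. 4.4 for `O_μ` IS a sequence of companion steps (card §C6-2).  PROVED (tree
`MarkedIdeal.transform_sum`). [cite: BierstoneGrigorievMilmanWlodarczyk2011, Lemma 3.7.1 (1)] -/
theorem transform_companion [IsLocallyNoetherian X'] (hE : IsEffectiveCartier (C.comap τ))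
    (B : List X.IdealSheafData) (D J : X.IdealSheafData) {N μ : ℕ}
    (hJ : J.comap τ ≤ C.comap τ ^ μ) (hD : D.comap τ ≤ C.comap τ ^ (N - μ)) :
    (companion B D J N μ).transform τ C =
      ((⟨J, B, μ⟩ : MarkedIdeal X).transform τ C).sum ((⟨D, B, N - μ⟩ : MarkedIdeal X).transform τ C) :=
  MarkedIdeal.transform_sum hE _ _ hJ hD

/-- [OURS · L1 W5.2] **… and with the stripped object**: `(D · J, N)' = (D', N-μ) · (J', μ)`, i.e. the
X-side weight-`ℓ` weak transform of the flag ideal is again `D' · J'` (card §C6-2).  PROVED (tree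
`MarkedIdeal.transform_prod`). [cite: BierstoneGrigorievMilmanWlodarczyk2011, Lemma 3.7.1 (2)] -/
theorem transform_stripped [IsLocallyNoetherian X'] (hE : IsEffectiveCartier (C.comap τ))
    (B : List X.IdealSheafData) (D J : X.IdealSheafData) {N μ : ℕ}
    (hJ : J.comap τ ≤ C.comap τ ^ μ) (hD : D.comap τ ≤ C.comap τ ^ (N - μ)) :
    ((⟨D, B, N - μ⟩ : MarkedIdeal X).prod ⟨J, B, μ⟩).transform τ C =
      ((⟨D, B, N - μ⟩ : MarkedIdeal X).transform τ C).prod ((⟨J, B, μ⟩ : MarkedIdeal X).transform τ C) :=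
  MarkedIdeal.transform_prod hE _ _ hD hJ

end Transform


end DepthCascade

end Summit.ResolutionOfSingularities.ResolutionOfSingularities.Theorems

end
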